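import Summits.QuantumFields.YangMills.Theorems.ColdStartUniversalityLatticeLangevinLiebRobinsonClusteringWilsonLoops
import HarnessLib

/-!
# Route `ColdStartUniversality` (fixed-cut-off SZZ dynamics; LIEB–ROBINSON / LOCALITY package, file 19):
# ★★★ LOOP–PLAQUETTE COVARIANCES ARE ABSOLUTELY SUMMABLE OVER THE WHOLE TORUS, UNIFORMLY IN THE VOLUME (`|β'| < 1/12`)

Helper file (seat `ym-line-csu-p1`, g31; `--supports stmt-QuantumFields-24809`).  The first consequence of exponential clustering (file 16/17)
that the Poincaré inequality alone cannot give: for the `SU(2)` Wilson measure `μ_(β')` on `(ℤ/L)³` at `|β'| < 1/12` and a loop word `w`,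
`Σ_p |Cov_(μ_β')(Re tr w, Re tr U_p)| ≤ C(β', |w|)` with `C` INDEPENDENT OF `L` (Poincaré only gives `|Cov(W, Σ_p Re tr U_p)| = O(L^(3/2))`).
* §1 bookkeeping: `two_mul_add_one_le_mul_exp`, `two_mul_add_one_pow_three_le_mul_exp` (`(2d+1)³ ≤ (1+12/κ)³e^(κd/2)`), `one_add_mul_exp_neg_le`
  (`(1+T)e^(−ρT) ≤ (2/ρ)e^(−ρT/2)`), ★ `sum_exp_neg_mul_torusDist_le` (`Σ_y e^(−κD(x,y)) ≤ (1+12/κ)³/(1−e^(−κ/2))`, VOLUME-FREE, any rate `κ > 0`);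
* §2 dictionary: `word_plaquette_eq` (`Re tr ρ(U_p)` = the flat-coordinate word of `[(y,i),(y+eᵢ,j),(y+eⱼ,i)⁻¹,(y,j)⁻¹]`), `wilsonAction_eq_sum_word`;
* §3 `sum_word_profile_le`, `wilson_loop_covariance_abs_le_trivial` (`≤ 32π²|w₁|²|w₂|²`, no separation), ★★ `wilson_loop_plaquette_covariance_abs_le`
  (`|Cov(Re tr w, Re tr U_p)| ≤ (1024π²|w|²/ρ)e^κ e^(−κd)` when the loop's base sites are at sup-distance `≥ d` from the plaquette's base site,
  `κ = ρ log 108/(2(λ+ρ))`);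
* §4 ★★★ `sum_plaquette_covariance_abs_le` — `Σ_p |Cov(Re tr w, Re tr U_p)| ≤ 3|w|·(1024π²|w|²/ρ)e^κ·(1+12/κ)³/(1−e^(−κ/2))`, every `L`.
THEOREMS ONLY, no definition, no sorry; [folklore].  HONEST FRAMING: fixed cut-off, FIXED strong-coupling window `|β'| < 1/12`; nothing `K`-uniform along
the route's scaling; `UniformColdStartMixing` (24809) is NOT restated; no crux, rung or summit statement is proved; the Yang–Mills mass gap is NOT proved.
-/

set_option autoImplicit false

noncomputable section

namespace Summit.QuantumFields.YangMills.Theorems.ColdStartUniversality.LiebRobinson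

open MeasureTheory ProbabilityTheory Matrix Complex Finset Filter Set Metric
open scoped ComplexConjugate BigOperators Matrix NNReal ENNReal Topology
open Literature.Probability.Process Literature.MathematicalPhysics.QuantumFieldTheory
open Literature.MathematicalPhysics.QuantumFieldTheory.Balaban1983to89
open Literature.MathematicalPhysics.QuantumLattice (fundamentalRep fundamentalLatticeRep continuous_fundamentalRep fundamentalRep_apply)

variable {L : ℕ} [NeZero L]

/-! ## §1. Elementary real-analysis bookkeeping -/

omit [NeZero L] in
/-- `2d + 1 ≤ (1 + 2/s)·e^(s d)` for `s > 0`. [folklore] -/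
theorem two_mul_add_one_le_mul_exp (d : ℕ) {s : ℝ} (hs : 0 < s) :
    2 * (d : ℝ) + 1 ≤ (1 + 2 / s) * Real.exp (s * d) := by
  have h1 : s * d + 1 ≤ Real.exp (s * d) := Real.add_one_le_exp _
  have h2 : 1 ≤ Real.exp (s * d) := Real.one_le_exp (by positivity)
  have hd : (d : ℝ) ≤ Real.exp (s * d) / s := by
    rw [le_div_iff₀ hs]; nlinarith
  calc 2 * (d : ℝ) + 1 ≤ 2 * (Real.exp (s * d) / s) + Real.exp (s * d) := by linarith
    _ = (1 + 2 / s) * Real.exp (s * d) := by ring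

omit [NeZero L] in
/-- `(2d + 1)³ ≤ (1 + 12/κ)³·e^(κ d/2)` for `κ > 0`. [folklore] -/
theorem two_mul_add_one_pow_three_le_mul_exp (d : ℕ) {κ : ℝ} (hκ : 0 < κ) :
    (2 * (d : ℝ) + 1) ^ 3 ≤ (1 + 12 / κ) ^ 3 * Real.exp (κ / 2 * d) := by
  have hs : 0 < κ / 6 := by positivity
  have h := two_mul_add_one_le_mul_exp d hs
  have h12 : (1 + 2 / (κ / 6)) = 1 + 12 / κ := by field_simp; ring
  rw [h12] at h
  have h0 : 0 ≤ 2 * (d : ℝ) + 1 := by positivity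
  calc (2 * (d : ℝ) + 1) ^ 3 ≤ ((1 + 12 / κ) * Real.exp (κ / 6 * d)) ^ 3 := pow_le_pow_left₀ h0 h 3
    _ = (1 + 12 / κ) ^ 3 * (Real.exp (κ / 6 * d)) ^ 3 := mul_pow _ _ _
    _ = (1 + 12 / κ) ^ 3 * Real.exp (κ / 2 * d) := by
        rw [← Real.exp_nat_mul]; congr 1; push_cast; ring_nf

omit [NeZero L] in
/-- `(1 + T)·e^(−ρT) ≤ (2/ρ)·e^(−ρT/2)` for every real `T` and `0 < ρ ≤ 2`. [folklore] -/
theorem one_add_mul_exp_neg_le (T : ℝ) {ρ : ℝ} (hρ : 0 < ρ) (hρ2 : ρ ≤ 2) :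
    (1 + T) * Real.exp (-(ρ * T)) ≤ 2 / ρ * Real.exp (-(ρ * T / 2)) := by
  have h1 : ρ * T / 2 + 1 ≤ Real.exp (ρ * T / 2) := Real.add_one_le_exp _
  have hE : 0 < Real.exp (ρ * T / 2) := Real.exp_pos _
  have h2 : 1 + T ≤ 2 / ρ * Real.exp (ρ * T / 2) := by
    have h3 : T ≤ 2 / ρ * (Real.exp (ρ * T / 2) - 1) := by
      rw [div_mul_eq_mul_div, le_div_iff₀ hρ]; nlinarith
    have h4 : 1 ≤ 2 / ρ := by rw [le_div_iff₀ hρ]; linarith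
    nlinarith
  have hsplit : Real.exp (-(ρ * T)) = Real.exp (-(ρ * T / 2)) * Real.exp (-(ρ * T / 2)) := by
    rw [← Real.exp_add]; ring_nf
  have hinv : Real.exp (ρ * T / 2) * Real.exp (-(ρ * T / 2)) = 1 := by
    rw [← Real.exp_add, add_neg_cancel, Real.exp_zero]
  calc (1 + T) * Real.exp (-(ρ * T)) ≤ (2 / ρ * Real.exp (ρ * T / 2)) * Real.exp (-(ρ * T)) :=
      mul_le_mul_of_nonneg_right h2 (Real.exp_pos _).le
    _ = 2 / ρ * Real.exp (-(ρ * T / 2)) * (Real.exp (ρ * T / 2) * Real.exp (-(ρ * T / 2))) := by rw [hsplit]; ring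
    _ = 2 / ρ * Real.exp (-(ρ * T / 2)) := by rw [hinv, mul_one]

/-- ★ **Volume-free exponential sums over the torus at ANY rate**: for `κ > 0` and every `L`,
`Σ_y e^(−κ·D(x,y)) ≤ (1 + 12/κ)³/(1 − e^(−κ/2))` (shells have `≤ (2d+1)³ ≤ (1+12/κ)³e^(κd/2)` points; geometric series). [folklore] -/
theorem sum_exp_neg_mul_torusDist_le (x : Literature.MathematicalPhysics.QuantumFieldTheory.Site 3 L) {κ : ℝ} (hκ : 0 < κ) :
    ∑ y : Literature.MathematicalPhysics.QuantumFieldTheory.Site 3 L,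
        Real.exp (-(κ * (Finset.univ.sup fun i : Fin 3 => ((y i - x i).valMinAbs).natAbs : ℕ))) ≤
      (1 + 12 / κ) ^ 3 / (1 - Real.exp (-(κ / 2))) := by
  classical
  set D : Literature.MathematicalPhysics.QuantumFieldTheory.Site 3 L → ℕ := fun y =>
    Finset.univ.sup fun i : Fin 3 => ((y i - x i).valMinAbs).natAbs with hD
  set M : ℕ := Finset.univ.sup D with hM
  have hDle : ∀ y, D y ≤ M := fun y => Finset.le_sup (f := D) (Finset.mem_univ y)
  have hfib : ∑ y : Literature.MathematicalPhysics.QuantumFieldTheory.Site 3 L, Real.exp (-(κ * (D y : ℕ))) =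
      ∑ d ∈ Finset.range (M + 1), ((Finset.univ.filter fun y => D y = d).card : ℝ) * Real.exp (-(κ * (d : ℕ))) := by
    rw [← Finset.sum_fiberwise_of_maps_to (s := Finset.univ) (t := Finset.range (M + 1)) (g := D)
      (fun y _ => Finset.mem_range.2 (Nat.lt_succ_of_le (hDle y)))]
    refine Finset.sum_congr rfl fun d _ => ?_
    have : ∀ y ∈ Finset.univ.filter (fun y => D y = d), Real.exp (-(κ * (D y : ℕ))) = Real.exp (-(κ * (d : ℕ))) := fun y hy => by
      rw [(Finset.mem_filter.1 hy).2]
    rw [Finset.sum_congr rfl this, Finset.sum_const, nsmul_eq_mul]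
  rw [hfib]
  set q : ℝ := Real.exp (-(κ / 2)) with hq
  have hq0 : 0 ≤ q := (Real.exp_pos _).le
  have hq1 : q < 1 := by rw [hq]; exact Real.exp_lt_one_iff.2 (by linarith)
  have hC0 : 0 ≤ (1 + 12 / κ) ^ 3 := by positivity
  have hshell : ∀ d : ℕ, ((Finset.univ.filter fun y => D y = d).card : ℝ) * Real.exp (-(κ * (d : ℕ))) ≤
      (1 + 12 / κ) ^ 3 * q ^ d := by
    intro d
    have h1 : (Finset.univ.filter fun y => D y = d).card ≤ (Finset.univ.filter fun y => D y ≤ d).card := by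
      refine Finset.card_le_card fun y hy => ?_
      simp only [Finset.mem_filter, Finset.mem_univ, true_and] at hy ⊢
      exact hy.le
    have h2 := card_torusBall_le x d
    have h3 : ((Finset.univ.filter fun y => D y = d).card : ℝ) ≤ (2 * (d : ℝ) + 1) ^ 3 := by
      have h4 : (Finset.univ.filter fun y => D y = d).card ≤ (2 * d + 1) ^ 3 := h1.trans h2
      exact_mod_cast h4
    have h5 := two_mul_add_one_pow_three_le_mul_exp d hκ
    have hqd : q ^ d = Real.exp (-(κ / 2 * d)) := by
      rw [hq, ← Real.exp_nat_mul]; congr 1; ring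
    have hsplit : Real.exp (κ / 2 * d) * Real.exp (-(κ * (d : ℕ))) = Real.exp (-(κ / 2 * d)) := by
      rw [← Real.exp_add]; congr 1; ring
    calc ((Finset.univ.filter fun y => D y = d).card : ℝ) * Real.exp (-(κ * (d : ℕ)))
        ≤ ((1 + 12 / κ) ^ 3 * Real.exp (κ / 2 * d)) * Real.exp (-(κ * (d : ℕ))) :=
          mul_le_mul_of_nonneg_right (h3.trans h5) (Real.exp_pos _).le
      _ = (1 + 12 / κ) ^ 3 * q ^ d := by rw [mul_assoc, hsplit, hqd]
  calc ∑ d ∈ Finset.range (M + 1), ((Finset.univ.filter fun y => D y = d).card : ℝ) * Real.exp (-(κ * (d : ℕ)))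
      ≤ ∑ d ∈ Finset.range (M + 1), (1 + 12 / κ) ^ 3 * q ^ d := Finset.sum_le_sum fun d _ => hshell d
    _ = (1 + 12 / κ) ^ 3 * ∑ d ∈ Finset.range (M + 1), q ^ d := by rw [Finset.mul_sum]
    _ ≤ (1 + 12 / κ) ^ 3 * (1 / (1 - q)) := by
        refine mul_le_mul_of_nonneg_left ?_ hC0
        have h := geom_sum_Ico_le_of_lt_one hq0 hq1 (m := 0) (n := M + 1)
        rw [pow_zero] at h
        rwa [Finset.range_eq_Ico]
    _ = (1 + 12 / κ) ^ 3 / (1 - q) := by ring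


/-! ## §2. The plaquette as a word of length four -/

omit [NeZero L] in
/-- **Dictionary: plaquette holonomy = word of length four.**  For the plaquette at `y` in the plane `(i, j)`:
`Re tr ρ(U_p) = Re tr (M_(y,i) M_(y+eᵢ,j) M_(y+eⱼ,i)ᴴ M_(y,j)ᴴ)` read through the real link coordinates, i.e. the flat-coordinate word observable
of the list `[((y,i),+), ((y+eᵢ,j),+), ((y+eⱼ,i),−), ((y,j),−)]` (`ρ(U⁻¹) = ρ(U)ᴴ` on `SU(2)`). [folklore] -/
theorem word_plaquette_eq (V : GaugeConfig 3 L (Matrix.specialUnitaryGroup (Fin 2) ℂ))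
    (x₀ : Literature.MathematicalPhysics.QuantumFieldTheory.Site 3 L) (i j : Fin 3) :
    let coords : GaugeConfig 3 L (Matrix.specialUnitaryGroup (Fin 2) ℂ) → (Edge 3 L × Fin 2 × Fin 2 × Bool → ℝ) :=
      fun V q => (fun z : ℂ => if q.2.2.2 then z.im else z.re)
        ((fundamentalRep (Fin 2) (V q.1) : Matrix (Fin 2) (Fin 2) ℂ) q.2.1 q.2.2.1)
    (fun y : (Edge 3 L × Fin 2 × Fin 2 × Bool → ℝ) => (([((x₀, i), false), ((Literature.MathematicalPhysics.QuantumFieldTheory.Site.shift x₀ i, j), false), ((Literature.MathematicalPhysics.QuantumFieldTheory.Site.shift x₀ j, i), true), ((x₀, j), true)].map (fun a : Edge 3 L × Bool => if a.2 then ((fun (ee : Edge 3 L) => Matrix.of fun (i j : Fin 2) => ((y (ee, i, j, false) : ℝ) : ℂ) + ((y (ee, i, j, true) : ℝ) : ℂ) * Complex.I) a.1)ᴴ else (fun (ee : Edge 3 L) => Matrix.of fun (i j : Fin 2) => ((y (ee, i, j, false) : ℝ) : ℂ) + ((y (ee, i, j, true) : ℝ) : ℂ) * Complex.I) a.1)).prod).trace.re)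 (coords V) =
      ((fundamentalRep (Fin 2) (plaquetteHolonomy V x₀ i j) : Matrix (Fin 2) (Fin 2) ℂ)).trace.re := by
  intro coords
  have hM : ∀ e : Edge 3 L, (Matrix.of fun (a b : Fin 2) => ((coords V (e, a, b, false) : ℝ) : ℂ) + ((coords V (e, a, b, true) : ℝ) : ℂ) * Complex.I) =
      (fundamentalRep (Fin 2) (V e) : Matrix (Fin 2) (Fin 2) ℂ) := by
    intro e; ext a b
    simp only [Matrix.of_apply]
    exact Complex.re_add_im _
  have hinv : ∀ U : Matrix.specialUnitaryGroup (Fin 2) ℂ,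
      (fundamentalRep (Fin 2) U⁻¹ : Matrix (Fin 2) (Fin 2) ℂ) = (fundamentalRep (Fin 2) U : Matrix (Fin 2) (Fin 2) ℂ)ᴴ := fun U => by
    rw [← Matrix.star_eq_inv]; rfl
  simp only [List.map, List.prod_cons, List.prod_nil, mul_one, Bool.false_eq_true, if_false, if_true, hM, plaquetteHolonomy,
    map_mul, hinv, Matrix.mul_assoc]

/-- **The Wilson action through words**: `S_W(V) = Σ_p (2 − Re tr w_p(coords V))` for the `SU(2)` fundamental representation on `(ℤ/L)³`. [folklore] -/
theorem wilsonAction_eq_sum_word (V : GaugeConfig 3 L (Matrix.specialUnitaryGroup (Fin 2) ℂ)) :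
    let coords : GaugeConfig 3 L (Matrix.specialUnitaryGroup (Fin 2) ℂ) → (Edge 3 L × Fin 2 × Fin 2 × Bool → ℝ) :=
      fun V q => (fun z : ℂ => if q.2.2.2 then z.im else z.re)
        ((fundamentalRep (Fin 2) (V q.1) : Matrix (Fin 2) (Fin 2) ℂ) q.2.1 q.2.2.1)
    Literature.MathematicalPhysics.QuantumFieldTheory.wilsonAction (fundamentalRep (Fin 2)) V =
      ∑ p : Plaquette 3 L, (2 - (fun (x₀ : Literature.MathematicalPhysics.QuantumFieldTheory.Site 3 L) (i j : Fin 3) => (fun y : (Edge 3 L × Fin 2 × Fin 2 × Bool → ℝ) => (([((x₀, i), false), ((Literature.MathematicalPhysics.QuantumFieldTheory.Site.shift x₀ i, j), false), ((Literature.MathematicalPhysics.QuantumFieldTheory.Site.shift x₀ j, i), true), ((x₀, j), true)].map (fun a : Edge 3 L × Bool => if a.2 then ((fun (ee : Edge 3 L) => Matrix.of fun (i j : Fin 2) => ((y (ee, i, j, false) : ℝ) : ℂ) + ((y (ee, i, j, true) : ℝ) : ℂ) * Complex.I) a.1)ᴴ else (fun (ee : Edge 3 L) => Matrix.of fun (i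 j : Fin 2) => ((y (ee, i, j, false) : ℝ) : ℂ) + ((y (ee, i, j, true) : ℝ) : ℂ) * Complex.I) a.1)).prod).trace.re) (coords V)) p.1 p.2.1.1 p.2.1.2) := by
  intro coords
  unfold Literature.MathematicalPhysics.QuantumFieldTheory.wilsonAction
  refine Finset.sum_congr rfl fun p _ => ?_
  have h : (fun y : (Edge 3 L × Fin 2 × Fin 2 × Bool → ℝ) => (([((p.1, p.2.1.1), false), ((Literature.MathematicalPhysics.QuantumFieldTheory.Site.shift p.1 p.2.1.1, p.2.1.2), false), ((Literature.MathematicalPhysics.QuantumFieldTheory.Site.shift p.1 p.2.1.2, p.2.1.1), true), ((p.1, p.2.1.2), true)].map (fun a : Edge 3 L × Bool => if a.2 then ((fun (ee : Edge 3 L) => Matrix.of fun (i j : Fin 2) => ((y (ee, i, j, false) : ℝ) : ℂ) + ((y (ee, i, j, true) : ℝ) : ℂ) * Complex.I) a.1)ᴴ else (fun (ee : Edge 3 L) => Matrix.of fun (i j : Fin 2) => ((y (ee, i, j, false) : ℝ) : ℂ) + ((y (ee, i, j, true) : ℝ) : ℂ) * Complex.I) a.1)).prod).trace.re) (coords V)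 =
      ((fundamentalRep (Fin 2) (plaquetteHolonomy V p.1 p.2.1.1 p.2.1.2) : Matrix (Fin 2) (Fin 2) ℂ)).trace.re :=
    word_plaquette_eq V p.1 p.2.1.1 p.2.1.2
  beta_reduce at h ⊢
  rw [h]
  norm_num


/-! ## §3. Loop–plaquette covariances -/

/-- The total link-Lipschitz profile of a word: `Σ_e ℓ^w_e ≤ 2π|w|²`. [folklore] -/
theorem sum_word_profile_le (l : List (Edge 3 L × Bool)) :
    (∑ e : Edge 3 L, (if e ∈ (l.map Prod.fst).toFinset then 2 * Real.pi * (l.length : ℝ) else 0)) ≤ 2 * Real.pi * (l.length : ℝ) ^ 2 := by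
  classical
  have hcard : (((l.map Prod.fst).toFinset.card : ℕ) : ℝ) ≤ l.length := by
    have h1 := List.toFinset_card_le (l.map Prod.fst)
    rw [List.length_map] at h1
    exact_mod_cast h1
  rw [Finset.sum_ite_mem, Finset.univ_inter, Finset.sum_const, nsmul_eq_mul]
  calc ((l.map Prod.fst).toFinset.card : ℝ) * (2 * Real.pi * (l.length : ℝ)) ≤ (l.length : ℝ) * (2 * Real.pi * (l.length : ℝ)) :=
      mul_le_mul_of_nonneg_right hcard (by positivity)
    _ = 2 * Real.pi * (l.length : ℝ) ^ 2 := by ring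

/-- **A priori bound on loop–loop covariances** (`|β'| < 1/12`, every `L`, no separation needed):
`|⟨Re tr w₁·Re tr w₂⟩_(μ_β') − ⟨Re tr w₁⟩⟨Re tr w₂⟩| ≤ 32π²|w₁|²|w₂|²` (`wilson_covariance_abs_le` at `T = 0` and `√Var ≤ 2√2·Σℓ`). [folklore] -/
theorem wilson_loop_covariance_abs_le_trivial (L : ℕ) [NeZero L] (β' : ℝ) (hβ : |β'| < 1 / 12) (l₁ l₂ : List (Edge 3 L × Bool)) :
    let coords : GaugeConfig 3 L (Matrix.specialUnitaryGroup (Fin 2) ℂ) → (Edge 3 L × Fin 2 × Fin 2 × Bool → ℝ) :=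
      fun V q => (fun z : ℂ => if q.2.2.2 then z.im else z.re)
        ((fundamentalRep (Fin 2) (V q.1) : Matrix (Fin 2) (Fin 2) ℂ) q.2.1 q.2.2.1)
    |(∫ x, (fun y : (Edge 3 L × Fin 2 × Fin 2 × Bool → ℝ) => ((l₁.map (fun a : Edge 3 L × Bool => if a.2 then ((fun (ee : Edge 3 L) => Matrix.of fun (i j : Fin 2) => ((y (ee, i, j, false) : ℝ) : ℂ) + ((y (ee, i, j, true) : ℝ) : ℂ) * Complex.I) a.1)ᴴ else (fun (ee : Edge 3 L) => Matrix.of fun (i j : Fin 2) => ((y (ee, i, j, false) : ℝ) : ℂ) + ((y (ee, i, j, true) : ℝ) : ℂ) * Complex.I) a.1)).prod).trace.re) (coords x) * (fun y : (Edge 3 L × Fin 2 × Fin 2 × Bool → ℝ) => ((l₂.map (fun a : Edge 3 L × Bool => if a.2 then ((fun (ee : Edge 3 L) => Matrix.of fun (i j : Fin 2) => ((y (ee, i, j, false) : ℝ) : ℂ) + ((y (ee, i, j, true) : ℝ) : ℂ) * Complex.I) a.1)ᴴ else (fun (ee : Edge 3 L) => Matrix.of fun (i j : Fin 2) => ((y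 (ee, i, j, false) : ℝ) : ℂ) + ((y (ee, i, j, true) : ℝ) : ℂ) * Complex.I) a.1)).prod).trace.re) (coords x) ∂(wilsonMeasure (d := 3) (L := L) (fundamentalRep (Fin 2)) β')) -
        (∫ x, (fun y : (Edge 3 L × Fin 2 × Fin 2 × Bool → ℝ) => ((l₁.map (fun a : Edge 3 L × Bool => if a.2 then ((fun (ee : Edge 3 L) => Matrix.of fun (i j : Fin 2) => ((y (ee, i, j, false) : ℝ) : ℂ) + ((y (ee, i, j, true) : ℝ) : ℂ) * Complex.I) a.1)ᴴ else (fun (ee : Edge 3 L) => Matrix.of fun (i j : Fin 2) => ((y (ee, i, j, false) : ℝ) : ℂ) + ((y (ee, i, j, true) : ℝ) : ℂ) * Complex.I) a.1)).prod).trace.re) (coords x) ∂(wilsonMeasure (d := 3) (L := L) (fundamentalRep (Fin 2)) β')) * (∫ x, (fun y : (Edge 3 L × Fin 2 × Fin 2 × Bool → ℝ) => ((l₂.map (fun a : Edge 3 L × Bool => if a.2 then ((fun (ee : Edge 3 L) => Matrix.of fun (i j : Fin 2) => ((y (ee, i, j, false) : ℝ) : ℂ) + ((y (ee, i, j, true)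 : ℝ) : ℂ) * Complex.I) a.1)ᴴ else (fun (ee : Edge 3 L) => Matrix.of fun (i j : Fin 2) => ((y (ee, i, j, false) : ℝ) : ℂ) + ((y (ee, i, j, true) : ℝ) : ℂ) * Complex.I) a.1)).prod).trace.re) (coords x) ∂(wilsonMeasure (d := 3) (L := L) (fundamentalRep (Fin 2)) β'))| ≤
      32 * Real.pi ^ 2 * (l₁.length : ℝ) ^ 2 * (l₂.length : ℝ) ^ 2 := by
  intro coords
  classical
  set ℓF : Edge 3 L → ℝ := fun e => if e ∈ (l₁.map Prod.fst).toFinset then 2 * Real.pi * (l₁.length : ℝ) else 0 with hℓF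
  set ℓG : Edge 3 L → ℝ := fun e => if e ∈ (l₂.map Prod.fst).toFinset then 2 * Real.pi * (l₂.length : ℝ) else 0 with hℓG
  have hℓF0 : ∀ e, 0 ≤ ℓF e := fun e => by
    simp only [hℓF]; split_ifs
    · positivity
    · exact le_rfl
  have hℓG0 : ∀ e, 0 ≤ ℓG e := fun e => by
    simp only [hℓG]; split_ifs
    · positivity
    · exact le_rfl
  have hLf := word_linkLipschitz_profile L β' l₁
  have hLg := word_linkLipschitz_profile L β' l₂
  have hco : Continuous coords := continuous_coords (L := L)
  have key := wilson_covariance_abs_le L β' hβ (contDiff_word (L := L) l₁ (m := 3)) hℓF0 (contDiff_word (L := L) l₂ (m := 3)) hℓG0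
    (le_refl (0 : ℝ)) (fun e y y' h => hLf e y y' h) (fun e y y' h => hLg e y y' h)
  have hVF := sqrt_variance_le_of_linkLipschitz L β' ((contDiff_word (L := L) l₁ (m := 3)).continuous.comp hco) hℓF0
    (fun e y y' h => hLf e y y' h)
  have hVG := sqrt_variance_le_of_linkLipschitz L β' ((contDiff_word (L := L) l₂ (m := 3)).continuous.comp hco) hℓG0
    (fun e y y' h => hLg e y y' h)
  have hF := sum_word_profile_le l₁
  have hG := sum_word_profile_le l₂
  have hSF : 0 ≤ ∑ e : Edge 3 L, ℓF e := Finset.sum_nonneg fun e _ => hℓF0 e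
  refine key.trans ?_
  simp only [mul_zero, neg_zero, Real.exp_zero, one_mul, zero_mul, add_zero]
  have hs : Real.sqrt 2 * Real.sqrt 2 = 2 := Real.mul_self_sqrt (by norm_num)
  calc _ ≤ (2 * Real.sqrt 2 * ∑ e : Edge 3 L, ℓF e) * (2 * Real.sqrt 2 * ∑ e : Edge 3 L, ℓG e) :=
        mul_le_mul hVF hVG (Real.sqrt_nonneg _) (by positivity)
    _ ≤ (2 * Real.sqrt 2 * (2 * Real.pi * (l₁.length : ℝ) ^ 2)) * (2 * Real.sqrt 2 * (2 * Real.pi * (l₂.length : ℝ) ^ 2)) :=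
        mul_le_mul (mul_le_mul_of_nonneg_left hF (by positivity)) (mul_le_mul_of_nonneg_left hG (by positivity)) (by positivity) (by positivity)
    _ = 16 * (Real.sqrt 2 * Real.sqrt 2) * Real.pi ^ 2 * (l₁.length : ℝ) ^ 2 * (l₂.length : ℝ) ^ 2 := by ring
    _ = 32 * Real.pi ^ 2 * (l₁.length : ℝ) ^ 2 * (l₂.length : ℝ) ^ 2 := by rw [hs]; ring

/-- ★★ **Loop–plaquette covariance at distance `d`** (`|β'| < 1/12`, every `L`): if every link of the loop word `w` has its base site at cyclic
sup-distance `≥ d` from the base site `y_p` of the plaquette `p`, then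
`|Cov_(μ_β')(Re tr w, Re tr U_p)| ≤ (1024π²|w|²/ρ)·e^κ·e^(−κd)`, `κ = ρ·log 108/(2(λ+ρ))`, `ρ = 1 − 12|β'|`, `λ = (1300+4√2)|β'|`
(for `d ≥ 2` the links of `p` are at distance `≥ d−1` and `wilson_loop_covariance_abs_le` applies with `R = d−2`, then `(1+T)e^(−ρT) ≤ (2/ρ)e^(−ρT/2)`;
for `d ≤ 1` the a priori bound `512π²|w|²` is smaller). [folklore] -/
theorem wilson_loop_plaquette_covariance_abs_le (L : ℕ) [NeZero L] (β' : ℝ) (hβ : |β'| < 1 / 12) (l₁ : List (Edge 3 L × Bool))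
    (p : Plaquette 3 L) (d : ℕ) (hd : ∀ e' ∈ (l₁.map Prod.fst).toFinset, d ≤ (Finset.univ.sup fun i : Fin 3 => ((e'.1 i - p.1 i).valMinAbs).natAbs)) :
    let coords : GaugeConfig 3 L (Matrix.specialUnitaryGroup (Fin 2) ℂ) → (Edge 3 L × Fin 2 × Fin 2 × Bool → ℝ) :=
      fun V q => (fun z : ℂ => if q.2.2.2 then z.im else z.re)
        ((fundamentalRep (Fin 2) (V q.1) : Matrix (Fin 2) (Fin 2) ℂ) q.2.1 q.2.2.1)
    |(∫ x, (fun y : (Edge 3 L × Fin 2 × Fin 2 × Bool → ℝ) => ((l₁.map (fun a : Edge 3 L × Bool => if a.2 then ((fun (ee : Edge 3 L) => Matrix.of fun (i j : Fin 2) => ((y (ee, i, j, false) : ℝ) : ℂ) + ((y (ee, i, j, true) : ℝ) : ℂ) * Complex.I) a.1)ᴴ else (fun (ee : Edge 3 L) => Matrix.of fun (i j : Fin 2) => ((y (ee, i, j, false) : ℝ) : ℂ) + ((y (ee, i, j, true) : ℝ) : ℂ) * Complex.I) a.1)).prod).trace.re) (coords x) * (fun y : (Edge 3 L × Fin 2 ×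 Fin 2 × Bool → ℝ) => (([((p.1, p.2.1.1), false), ((Literature.MathematicalPhysics.QuantumFieldTheory.Site.shift p.1 p.2.1.1, p.2.1.2), false), ((Literature.MathematicalPhysics.QuantumFieldTheory.Site.shift p.1 p.2.1.2, p.2.1.1), true), ((p.1, p.2.1.2), true)].map (fun a : Edge 3 L × Bool => if a.2 then ((fun (ee : Edge 3 L) => Matrix.of fun (i j : Fin 2) => ((y (ee, i, j, false) : ℝ) : ℂ) + ((y (ee, i, j, true) : ℝ) : ℂ) * Complex.I) a.1)ᴴ else (fun (ee : Edge 3 L) => Matrix.of fun (i j : Fin 2) => ((y (ee, i, j, false) : ℝ) : ℂ) + ((y (ee, i, j, true) : ℝ) : ℂ) * Complex.I) a.1)).prod).trace.re) (coords x) ∂(wilsonMeasure (d := 3) (L := L) (fundamentalRep (Fin 2)) β')) -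
        (∫ x, (fun y : (Edge 3 L × Fin 2 × Fin 2 × Bool → ℝ) => ((l₁.map (fun a : Edge 3 L × Bool => if a.2 then ((fun (ee : Edge 3 L) => Matrix.of fun (i j : Fin 2) => ((y (ee, i, j, false) : ℝ) : ℂ) + ((y (ee, i, j, true) : ℝ) : ℂ) * Complex.I) a.1)ᴴ else (fun (ee : Edge 3 L) => Matrix.of fun (i j : Fin 2) => ((y (ee, i, j, false) : ℝ) : ℂ) + ((y (ee, i, j, true) : ℝ) : ℂ) * Complex.I) a.1)).prod).trace.re) (coords x) ∂(wilsonMeasure (d := 3) (L := L) (fundamentalRep (Fin 2)) β')) * (∫ x, (fun y : (Edge 3 L × Fin 2 × Fin 2 × Bool → ℝ) => (([((p.1, p.2.1.1), false), ((Literature.MathematicalPhysics.QuantumFieldTheory.Site.shift p.1 p.2.1.1, p.2.1.2), false), ((Literature.MathematicalPhysics.QuantumFieldTheory.Site.shift p.1 p.2.1.2, p.2.1.1), true), ((p.1, p.2.1.2), true)].map (fun a : Edge 3 L × Bool => if a.2 then ((fun (ee : Edge 3 L) => Matrix.of fun (i j : Fin 2) => ((y (ee, i, j, false) : ℝ) :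 ℂ) + ((y (ee, i, j, true) : ℝ) : ℂ) * Complex.I) a.1)ᴴ else (fun (ee : Edge 3 L) => Matrix.of fun (i j : Fin 2) => ((y (ee, i, j, false) : ℝ) : ℂ) + ((y (ee, i, j, true) : ℝ) : ℂ) * Complex.I) a.1)).prod).trace.re) (coords x) ∂(wilsonMeasure (d := 3) (L := L) (fundamentalRep (Fin 2)) β'))| ≤
      1024 * Real.pi ^ 2 * (l₁.length : ℝ) ^ 2 / (1 - 12 * |β'|) * Real.exp ((1 - 12 * |β'|) * Real.log 108 / (2 * ((1300 + 4 * Real.sqrt 2) * |β'| + (1 - 12 * |β'|)))) * Real.exp (-(((1 - 12 * |β'|) * Real.log 108 / (2 * ((1300 + 4 * Real.sqrt 2) * |β'| + (1 - 12 * |β'|)))) * d)) := by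
  intro coords
  classical
  have hlam0 : 0 ≤ (1300 + 4 * Real.sqrt 2) * |β'| := by positivity
  have hrho : 0 < (1 - 12 * |β'|) := by linarith
  have hrho1 : (1 - 12 * |β'|) ≤ 1 := by have := abs_nonneg β'; linarith
  have hden : 0 < (1300 + 4 * Real.sqrt 2) * |β'| + (1 - 12 * |β'|) := by linarith
  have hlog : 0 < Real.log 108 := Real.log_pos (by norm_num)
  have hκ : 0 ≤ ((1 - 12 * |β'|) * Real.log 108 / (2 * ((1300 + 4 * Real.sqrt 2) * |β'| + (1 - 12 * |β'|)))) := by positivity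
  set A : ℝ := 1024 * Real.pi ^ 2 * (l₁.length : ℝ) ^ 2 / (1 - 12 * |β'|) with hA
  have hA0 : 0 ≤ A := by rw [hA]; positivity
  have hlen : (([((p.1, p.2.1.1), false), ((Literature.MathematicalPhysics.QuantumFieldTheory.Site.shift p.1 p.2.1.1, p.2.1.2), false), ((Literature.MathematicalPhysics.QuantumFieldTheory.Site.shift p.1 p.2.1.2, p.2.1.1), true), ((p.1, p.2.1.2), true)] : List (Edge 3 L × Bool)).length : ℝ) = 4 := by norm_num
  by_cases hd2 : 2 ≤ d
  · -- separated case: `R = d - 2`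
    obtain ⟨m, rfl⟩ := Nat.exists_eq_add_of_le' hd2
    have hsep : ∀ e' ∈ (l₁.map Prod.fst).toFinset, ∀ e ∈ (([((p.1, p.2.1.1), false), ((Literature.MathematicalPhysics.QuantumFieldTheory.Site.shift p.1 p.2.1.1, p.2.1.2), false), ((Literature.MathematicalPhysics.QuantumFieldTheory.Site.shift p.1 p.2.1.2, p.2.1.1), true), ((p.1, p.2.1.2), true)] : List (Edge 3 L × Bool)).map Prod.fst).toFinset,
        m + 1 ≤ (Finset.univ.sup fun i : Fin 3 => ((e'.1 i - e.1 i).valMinAbs).natAbs) := by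
      intro e' he' e he
      have hde := hd e' he'
      have hstep : ∀ (u : Literature.MathematicalPhysics.QuantumFieldTheory.Site 3 L), (∀ i, ((u i).valMinAbs).natAbs ≤ 1) →
          m + 1 ≤ (Finset.univ.sup fun i : Fin 3 => ((e'.1 i - (p.1 + u) i).valMinAbs).natAbs) := by
        intro u hu
        have h1 := torusDist_le_add_succ e'.1 p.1 u hu
        rw [torusDist_comm e'.1 p.1] at h1
        rw [torusDist_comm (p.1 + u) e'.1]
        omega
      simp only [List.map, List.mem_toFinset, List.mem_cons, or_false, List.not_mem_nil] at he
      rcases he with h | h | h | h <;> rw [h] <;> dsimp only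
      · have := hde; omega
      · exact hstep _ (natAbs_valMinAbs_single_le p.2.1.1)
      · exact hstep _ (natAbs_valMinAbs_single_le p.2.1.2)
      · have := hde; omega
    have key := wilson_loop_covariance_abs_le L β' hβ l₁ [((p.1, p.2.1.1), false), ((Literature.MathematicalPhysics.QuantumFieldTheory.Site.shift p.1 p.2.1.1, p.2.1.2), false), ((Literature.MathematicalPhysics.QuantumFieldTheory.Site.shift p.1 p.2.1.2, p.2.1.1), true), ((p.1, p.2.1.2), true)] m hsep
    refine key.trans ?_
    rw [hlen]
    set T : ℝ := ((m : ℝ) + 1) * Real.log 108 / ((1300 + 4 * Real.sqrt 2) * |β'| + (1 - 12 * |β'|)) with hT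
    have hT0 : 0 ≤ T := by rw [hT]; positivity
    have h1 := one_add_mul_exp_neg_le T hrho (by linarith)
    have hexp : Real.exp (-((1 - 12 * |β'|) * T / 2)) = Real.exp ((1 - 12 * |β'|) * Real.log 108 / (2 * ((1300 + 4 * Real.sqrt 2) * |β'| + (1 - 12 * |β'|)))) * Real.exp (-(((1 - 12 * |β'|) * Real.log 108 / (2 * ((1300 + 4 * Real.sqrt 2) * |β'| + (1 - 12 * |β'|)))) * ((m + 2 : ℕ) : ℝ))) := by
      rw [← Real.exp_add]; congr 1; rw [hT]; push_cast; field_simp; ring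
    calc 32 * Real.pi ^ 2 * (l₁.length : ℝ) ^ 2 * (4 : ℝ) ^ 2 * (1 + T) * Real.exp (-((1 - 12 * |β'|) * T))
        = 512 * Real.pi ^ 2 * (l₁.length : ℝ) ^ 2 * ((1 + T) * Real.exp (-((1 - 12 * |β'|) * T))) := by ring
      _ ≤ 512 * Real.pi ^ 2 * (l₁.length : ℝ) ^ 2 * (2 / (1 - 12 * |β'|) * Real.exp (-((1 - 12 * |β'|) * T / 2))) :=
          mul_le_mul_of_nonneg_left h1 (by positivity)
      _ = A * (Real.exp ((1 - 12 * |β'|) * Real.log 108 / (2 * ((1300 + 4 * Real.sqrt 2) * |β'| + (1 - 12 * |β'|)))) * Real.exp (-(((1 - 12 * |β'|) * Real.log 108 / (2 * ((1300 + 4 * Real.sqrt 2) * |β'| + (1 - 12 * |β'|)))) * ((m + 2 : ℕ) : ℝ)))) := by rw [← hexp, hA]; ring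
      _ = A * Real.exp ((1 - 12 * |β'|) * Real.log 108 / (2 * ((1300 + 4 * Real.sqrt 2) * |β'| + (1 - 12 * |β'|)))) * Real.exp (-(((1 - 12 * |β'|) * Real.log 108 / (2 * ((1300 + 4 * Real.sqrt 2) * |β'| + (1 - 12 * |β'|)))) * ((m + 2 : ℕ) : ℝ))) := by ring
  · -- close case: the a priori bound
    push Not at hd2
    have key := wilson_loop_covariance_abs_le_trivial L β' hβ l₁ [((p.1, p.2.1.1), false), ((Literature.MathematicalPhysics.QuantumFieldTheory.Site.shift p.1 p.2.1.1, p.2.1.2), false), ((Literature.MathematicalPhysics.QuantumFieldTheory.Site.shift p.1 p.2.1.2, p.2.1.1), true), ((p.1, p.2.1.2), true)]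
    refine key.trans ?_
    rw [hlen]
    have hd1 : (d : ℝ) ≤ 1 := by exact_mod_cast Nat.lt_succ_iff.1 hd2
    have hE : 1 ≤ Real.exp ((1 - 12 * |β'|) * Real.log 108 / (2 * ((1300 + 4 * Real.sqrt 2) * |β'| + (1 - 12 * |β'|)))) * Real.exp (-(((1 - 12 * |β'|) * Real.log 108 / (2 * ((1300 + 4 * Real.sqrt 2) * |β'| + (1 - 12 * |β'|)))) * d)) := by
      rw [← Real.exp_add]
      exact Real.one_le_exp (by nlinarith)
    have hA' : 512 * Real.pi ^ 2 * (l₁.length : ℝ) ^ 2 ≤ A := by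
      rw [hA, le_div_iff₀ hrho]
      have h0 : 0 ≤ 512 * Real.pi ^ 2 * (l₁.length : ℝ) ^ 2 := by positivity
      nlinarith
    calc 32 * Real.pi ^ 2 * (l₁.length : ℝ) ^ 2 * (4 : ℝ) ^ 2 = 512 * Real.pi ^ 2 * (l₁.length : ℝ) ^ 2 * 1 := by ring
      _ ≤ A * (Real.exp ((1 - 12 * |β'|) * Real.log 108 / (2 * ((1300 + 4 * Real.sqrt 2) * |β'| + (1 - 12 * |β'|)))) * Real.exp (-(((1 - 12 * |β'|) * Real.log 108 / (2 * ((1300 + 4 * Real.sqrt 2) * |β'| + (1 - 12 * |β'|)))) * d))) := mul_le_mul hA' hE zero_le_one hA0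
      _ = A * Real.exp ((1 - 12 * |β'|) * Real.log 108 / (2 * ((1300 + 4 * Real.sqrt 2) * |β'| + (1 - 12 * |β'|)))) * Real.exp (-(((1 - 12 * |β'|) * Real.log 108 / (2 * ((1300 + 4 * Real.sqrt 2) * |β'| + (1 - 12 * |β'|)))) * d)) := by ring


/-! ## §4. The sum over ALL plaquettes is bounded uniformly in the volume -/

/-- ★★★ **Absolute summability of loop–plaquette covariances over the whole torus, uniformly in `L`** (`|β'| < 1/12`): for every
non-empty loop word `w`,
`Σ_p |Cov_(μ_β')(Re tr w, Re tr U_p)| ≤ 3·|w|·(1024π²|w|²/ρ)·e^κ·(1 + 12/κ)³/(1 − e^(−κ/2))`, `κ = ρ log 108/(2(λ+ρ))` — the right-hand side does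
not depend on `L` (the covariance at distance `d` is `≲ e^(−κd)` by `wilson_loop_plaquette_covariance_abs_le`; plaquettes are counted through their
base sites with `sum_exp_neg_mul_torusDist_le`).  This is the first consequence of the package that NEEDS clustering: the Poincaré inequality alone
gives `|Cov(W, Σ_p Re tr U_p)| ≤ √Var W·√Var(Σ_p) = O(L^(3/2))`. [folklore] -/
theorem sum_plaquette_covariance_abs_le (L : ℕ) [NeZero L] (β' : ℝ) (hβ : |β'| < 1 / 12) (l₁ : List (Edge 3 L × Bool)) (hl₁ : l₁ ≠ []) :
    let coords : GaugeConfig 3 L (Matrix.specialUnitaryGroup (Fin 2) ℂ) → (Edge 3 L × Fin 2 × Fin 2 × Bool → ℝ) :=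
      fun V q => (fun z : ℂ => if q.2.2.2 then z.im else z.re)
        ((fundamentalRep (Fin 2) (V q.1) : Matrix (Fin 2) (Fin 2) ℂ) q.2.1 q.2.2.1)
    ∑ p : Plaquette 3 L, |((∫ x, (fun y : (Edge 3 L × Fin 2 × Fin 2 × Bool → ℝ) => ((l₁.map (fun a : Edge 3 L × Bool => if a.2 then ((fun (ee : Edge 3 L) => Matrix.of fun (i j : Fin 2) => ((y (ee, i, j, false) : ℝ) : ℂ) + ((y (ee, i, j, true) : ℝ) : ℂ) * Complex.I) a.1)ᴴ else (fun (ee : Edge 3 L) => Matrix.of fun (i j : Fin 2) => ((y (ee, i, j, false) : ℝ) : ℂ) + ((y (ee, i, j, true) : ℝ) : ℂ) * Complex.I) a.1)).prod).trace.re) (coords x) * (fun y : (Edge 3 L × Fin 2 × Fin 2 × Bool → ℝ) => (([((p.1, p.2.1.1), false), ((Literature.MathematicalPhysics.QuantumFieldTheory.Site.shift p.1 p.2.1.1, p.2.1.2), false), ((Literature.MathematicalPhysics.QuantumFieldTheory.Site.shift p.1 p.2.1.2, p.2.1.1), true), ((p.1, p.2.1.2), true)].map (fun a : Edge 3 L ×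 Bool => if a.2 then ((fun (ee : Edge 3 L) => Matrix.of fun (i j : Fin 2) => ((y (ee, i, j, false) : ℝ) : ℂ) + ((y (ee, i, j, true) : ℝ) : ℂ) * Complex.I) a.1)ᴴ else (fun (ee : Edge 3 L) => Matrix.of fun (i j : Fin 2) => ((y (ee, i, j, false) : ℝ) : ℂ) + ((y (ee, i, j, true) : ℝ) : ℂ) * Complex.I) a.1)).prod).trace.re) (coords x) ∂(wilsonMeasure (d := 3) (L := L) (fundamentalRep (Fin 2)) β')) - (∫ x, (fun y : (Edge 3 L × Fin 2 × Fin 2 × Bool → ℝ) => ((l₁.map (fun a : Edge 3 L × Bool => if a.2 then ((fun (ee : Edge 3 L) => Matrix.of fun (i j : Fin 2) => ((y (ee, i, j, false) : ℝ) : ℂ) + ((y (ee, i, j, true) : ℝ) : ℂ) * Complex.I) a.1)ᴴ else (fun (ee : Edge 3 L) => Matrix.of fun (i j : Fin 2) => ((y (ee, i, j, false) : ℝ) : ℂ) + ((y (ee, i, j, true) : ℝ) : ℂ) * Complex.I) a.1)).prod).trace.re) (coords x) ∂(wilsonMeasure (d := 3) (L := L) (fundamentalRep (Fin 2)) β'))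 * (∫ x, (fun y : (Edge 3 L × Fin 2 × Fin 2 × Bool → ℝ) => (([((p.1, p.2.1.1), false), ((Literature.MathematicalPhysics.QuantumFieldTheory.Site.shift p.1 p.2.1.1, p.2.1.2), false), ((Literature.MathematicalPhysics.QuantumFieldTheory.Site.shift p.1 p.2.1.2, p.2.1.1), true), ((p.1, p.2.1.2), true)].map (fun a : Edge 3 L × Bool => if a.2 then ((fun (ee : Edge 3 L) => Matrix.of fun (i j : Fin 2) => ((y (ee, i, j, false) : ℝ) : ℂ) + ((y (ee, i, j, true) : ℝ) : ℂ) * Complex.I) a.1)ᴴ else (fun (ee : Edge 3 L) => Matrix.of fun (i j : Fin 2) => ((y (ee, i, j, false) : ℝ) : ℂ) + ((y (ee, i, j, true) : ℝ) : ℂ) * Complex.I) a.1)).prod).trace.re) (coords x) ∂(wilsonMeasure (d := 3) (L := L) (fundamentalRep (Fin 2)) β')))| ≤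
      3 * (l₁.length : ℝ) * ((1024 * Real.pi ^ 2 * (l₁.length : ℝ) ^ 2 / (1 - 12 * |β'|)) * Real.exp ((1 - 12 * |β'|) * Real.log 108 / (2 * ((1300 + 4 * Real.sqrt 2) * |β'| + (1 - 12 * |β'|))))) * ((1 + 12 / ((1 - 12 * |β'|) * Real.log 108 / (2 * ((1300 + 4 * Real.sqrt 2) * |β'| + (1 - 12 * |β'|))))) ^ 3 / (1 - Real.exp (-(((1 - 12 * |β'|) * Real.log 108 / (2 * ((1300 + 4 * Real.sqrt 2) * |β'| + (1 - 12 * |β'|)))) / 2)))) := by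
  intro coords
  classical
  have hlam0 : 0 ≤ (1300 + 4 * Real.sqrt 2) * |β'| := by positivity
  have hrho : 0 < (1 - 12 * |β'|) := by linarith
  have hden : 0 < (1300 + 4 * Real.sqrt 2) * |β'| + (1 - 12 * |β'|) := by linarith
  have hlog : 0 < Real.log 108 := Real.log_pos (by norm_num)
  have hκ : 0 < ((1 - 12 * |β'|) * Real.log 108 / (2 * ((1300 + 4 * Real.sqrt 2) * |β'| + (1 - 12 * |β'|)))) := by positivity
  set κ : ℝ := ((1 - 12 * |β'|) * Real.log 108 / (2 * ((1300 + 4 * Real.sqrt 2) * |β'| + (1 - 12 * |β'|)))) with hκdef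
  set B : ℝ := (1024 * Real.pi ^ 2 * (l₁.length : ℝ) ^ 2 / (1 - 12 * |β'|)) * Real.exp κ with hB
  have hB0 : 0 ≤ B := by rw [hB]; positivity
  set S₁ : Finset (Edge 3 L) := (l₁.map Prod.fst).toFinset with hS₁
  have hS₁ne : S₁.Nonempty := by
    rw [hS₁, List.toFinset_nonempty_iff]
    intro h
    exact hl₁ (List.map_eq_nil_iff.1 h)
  -- per plaquette: the bound at the distance to the nearest link of the loop, dominated by the sum over the loop's links
  have hper : ∀ p : Plaquette 3 L, |((∫ x, (fun y : (Edge 3 L × Fin 2 × Fin 2 × Bool → ℝ) => ((l₁.map (fun a : Edge 3 L × Bool => if a.2 then ((fun (ee : Edge 3 L) => Matrix.of fun (i j : Fin 2) => ((y (ee, i, j, false) : ℝ) : ℂ) + ((y (ee, i, j, true) : ℝ) : ℂ) * Complex.I) a.1)ᴴ else (fun (ee : Edge 3 L) => Matrix.of fun (i j : Fin 2) => ((y (ee, i, j, false) : ℝ) : ℂ) + ((y (ee, i, j, true) : ℝ) : ℂ) * Complex.I) a.1)).prod).trace.re) (coords x) * (fun y : (Edge 3 L × Fin 2 × Fin 2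 × Bool → ℝ) => (([((p.1, p.2.1.1), false), ((Literature.MathematicalPhysics.QuantumFieldTheory.Site.shift p.1 p.2.1.1, p.2.1.2), false), ((Literature.MathematicalPhysics.QuantumFieldTheory.Site.shift p.1 p.2.1.2, p.2.1.1), true), ((p.1, p.2.1.2), true)].map (fun a : Edge 3 L × Bool => if a.2 then ((fun (ee : Edge 3 L) => Matrix.of fun (i j : Fin 2) => ((y (ee, i, j, false) : ℝ) : ℂ) + ((y (ee, i, j, true) : ℝ) : ℂ) * Complex.I) a.1)ᴴ else (fun (ee : Edge 3 L) => Matrix.of fun (i j : Fin 2) => ((y (ee, i, j, false) : ℝ) : ℂ) + ((y (ee, i, j, true) : ℝ) : ℂ) * Complex.I) a.1)).prod).trace.re) (coords x) ∂(wilsonMeasure (d := 3) (L := L) (fundamentalRep (Fin 2)) β')) - (∫ x, (fun y : (Edge 3 L × Fin 2 × Fin 2 × Bool → ℝ) => ((l₁.map (fun a : Edge 3 L × Bool => if a.2 then ((fun (ee : Edge 3 L) => Matrix.of fun (i j : Fin 2) => ((y (ee, i, j, false) : ℝ) : ℂ) + ((y (ee, i, j, true) : ℝ) : ℂ) * Complex.I)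 a.1)ᴴ else (fun (ee : Edge 3 L) => Matrix.of fun (i j : Fin 2) => ((y (ee, i, j, false) : ℝ) : ℂ) + ((y (ee, i, j, true) : ℝ) : ℂ) * Complex.I) a.1)).prod).trace.re) (coords x) ∂(wilsonMeasure (d := 3) (L := L) (fundamentalRep (Fin 2)) β')) * (∫ x, (fun y : (Edge 3 L × Fin 2 × Fin 2 × Bool → ℝ) => (([((p.1, p.2.1.1), false), ((Literature.MathematicalPhysics.QuantumFieldTheory.Site.shift p.1 p.2.1.1, p.2.1.2), false), ((Literature.MathematicalPhysics.QuantumFieldTheory.Site.shift p.1 p.2.1.2, p.2.1.1), true), ((p.1, p.2.1.2), true)].map (fun a : Edge 3 L × Bool => if a.2 then ((fun (ee : Edge 3 L) => Matrix.of fun (i j : Fin 2) => ((y (ee, i, j, false) : ℝ) : ℂ) + ((y (ee, i, j, true) : ℝ) : ℂ) * Complex.I) a.1)ᴴ else (fun (ee : Edge 3 L) => Matrix.of fun (i j : Fin 2) => ((y (ee, i, j, false) : ℝ) : ℂ) + ((y (ee, i, j, true) : ℝ) : ℂ) * Complex.I) a.1)).prod).trace.re) (coords x) ∂(wilsonMeasure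 (d := 3) (L := L) (fundamentalRep (Fin 2)) β')))| ≤
      ∑ e' ∈ S₁, B * Real.exp (-(κ * ((Finset.univ.sup fun i : Fin 3 => ((e'.1 i - p.1 i).valMinAbs).natAbs : ℕ) : ℝ))) := by
    intro p
    obtain ⟨e₀, he₀, hmin⟩ := Finset.exists_min_image S₁
      (fun e' : Edge 3 L => (Finset.univ.sup fun i : Fin 3 => ((e'.1 i - p.1 i).valMinAbs).natAbs)) hS₁ne
    have hd : ∀ e' ∈ (l₁.map Prod.fst).toFinset, (Finset.univ.sup fun i : Fin 3 => ((e₀.1 i - p.1 i).valMinAbs).natAbs) ≤ (Finset.univ.sup fun i : Fin 3 => ((e'.1 i - p.1 i).valMinAbs).natAbs) :=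
      fun e' he' => hmin e' he'
    have h := wilson_loop_plaquette_covariance_abs_le L β' hβ l₁ p _ hd
    refine h.trans ?_
    have hterm : B * Real.exp (-(κ * ((Finset.univ.sup fun i : Fin 3 => ((e₀.1 i - p.1 i).valMinAbs).natAbs : ℕ) : ℝ))) ≤
        ∑ e' ∈ S₁, B * Real.exp (-(κ * ((Finset.univ.sup fun i : Fin 3 => ((e'.1 i - p.1 i).valMinAbs).natAbs : ℕ) : ℝ))) :=
      Finset.single_le_sum (f := fun e' : Edge 3 L => B * Real.exp (-(κ * ((Finset.univ.sup fun i : Fin 3 => ((e'.1 i - p.1 i).valMinAbs).natAbs : ℕ) : ℝ))))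
        (fun e' _ => mul_nonneg hB0 (Real.exp_pos _).le) he₀
    refine le_trans (le_of_eq ?_) hterm
    rw [hB]
  -- sum over plaquettes, exchange, count plaquettes through base sites
  have hplanes : (Fintype.card {q : Fin 3 × Fin 3 // q.1 < q.2} : ℝ) = 3 := by
    norm_cast
  have hsite : ∀ e' : Edge 3 L, ∑ p : Plaquette 3 L, Real.exp (-(κ * ((Finset.univ.sup fun i : Fin 3 => ((e'.1 i - p.1 i).valMinAbs).natAbs : ℕ) : ℝ))) ≤
      3 * ((1 + 12 / ((1 - 12 * |β'|) * Real.log 108 / (2 * ((1300 + 4 * Real.sqrt 2) * |β'| + (1 - 12 * |β'|))))) ^ 3 / (1 - Real.exp (-(((1 - 12 * |β'|) * Real.log 108 / (2 * ((1300 + 4 * Real.sqrt 2) * |β'| + (1 - 12 * |β'|)))) / 2)))) := by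
    intro e'
    rw [Fintype.sum_prod_type]
    simp only [Finset.sum_const, Finset.card_univ, nsmul_eq_mul]
    rw [← Finset.mul_sum, hplanes]
    refine mul_le_mul_of_nonneg_left ?_ (by norm_num)
    have h := sum_exp_neg_mul_torusDist_le (L := L) e'.1 hκ
    refine le_trans (le_of_eq (Finset.sum_congr rfl fun y _ => ?_)) h
    rw [torusDist_comm]
  have hcardS : (S₁.card : ℝ) ≤ l₁.length := by
    have h1 := List.toFinset_card_le (l₁.map Prod.fst)
    rw [List.length_map] at h1
    exact_mod_cast h1
  have hG0 : 0 ≤ ((1 + 12 / ((1 - 12 * |β'|) * Real.log 108 / (2 * ((1300 + 4 * Real.sqrt 2) * |β'| + (1 - 12 * |β'|))))) ^ 3 / (1 - Real.exp (-(((1 - 12 * |β'|) * Real.log 108 / (2 * ((1300 + 4 * Real.sqrt 2) * |β'| + (1 - 12 * |β'|)))) / 2)))) := by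
    have h1 : Real.exp (-(κ / 2)) < 1 := Real.exp_lt_one_iff.2 (by linarith)
    have h2 : 0 < 1 - Real.exp (-(κ / 2)) := by linarith
    positivity
  calc ∑ p : Plaquette 3 L, |((∫ x, (fun y : (Edge 3 L × Fin 2 × Fin 2 × Bool → ℝ) => ((l₁.map (fun a : Edge 3 L × Bool => if a.2 then ((fun (ee : Edge 3 L) => Matrix.of fun (i j : Fin 2) => ((y (ee, i, j, false) : ℝ) : ℂ) + ((y (ee, i, j, true) : ℝ) : ℂ) * Complex.I) a.1)ᴴ else (fun (ee : Edge 3 L) => Matrix.of fun (i j : Fin 2) => ((y (ee, i, j, false) : ℝ) : ℂ) + ((y (ee, i, j, true) : ℝ) : ℂ) * Complex.I) a.1)).prod).trace.re) (coords x) * (fun y : (Edge 3 L × Fin 2 × Fin 2 × Bool → ℝ) => (([((p.1, p.2.1.1), false), ((Literature.MathematicalPhysics.QuantumFieldTheory.Site.shift p.1 p.2.1.1, p.2.1.2), false), ((Literature.MathematicalPhysics.QuantumFieldTheory.Site.shift p.1 p.2.1.2, p.2.1.1), true), ((p.1, p.2.1.2), true)].map (fun a : Edge 3 L × Bool => if a.2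 then ((fun (ee : Edge 3 L) => Matrix.of fun (i j : Fin 2) => ((y (ee, i, j, false) : ℝ) : ℂ) + ((y (ee, i, j, true) : ℝ) : ℂ) * Complex.I) a.1)ᴴ else (fun (ee : Edge 3 L) => Matrix.of fun (i j : Fin 2) => ((y (ee, i, j, false) : ℝ) : ℂ) + ((y (ee, i, j, true) : ℝ) : ℂ) * Complex.I) a.1)).prod).trace.re) (coords x) ∂(wilsonMeasure (d := 3) (L := L) (fundamentalRep (Fin 2)) β')) - (∫ x, (fun y : (Edge 3 L × Fin 2 × Fin 2 × Bool → ℝ) => ((l₁.map (fun a : Edge 3 L × Bool => if a.2 then ((fun (ee : Edge 3 L) => Matrix.of fun (i j : Fin 2) => ((y (ee, i, j, false) : ℝ) : ℂ) + ((y (ee, i, j, true) : ℝ) : ℂ) * Complex.I) a.1)ᴴ else (fun (ee : Edge 3 L) => Matrix.of fun (i j : Fin 2) => ((y (ee, i, j, false) : ℝ) : ℂ) + ((y (ee, i, j, true) : ℝ) : ℂ) * Complex.I) a.1)).prod).trace.re) (coords x) ∂(wilsonMeasure (d := 3) (L := L) (fundamentalRep (Fin 2)) β')) * (∫ x, (fun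 y : (Edge 3 L × Fin 2 × Fin 2 × Bool → ℝ) => (([((p.1, p.2.1.1), false), ((Literature.MathematicalPhysics.QuantumFieldTheory.Site.shift p.1 p.2.1.1, p.2.1.2), false), ((Literature.MathematicalPhysics.QuantumFieldTheory.Site.shift p.1 p.2.1.2, p.2.1.1), true), ((p.1, p.2.1.2), true)].map (fun a : Edge 3 L × Bool => if a.2 then ((fun (ee : Edge 3 L) => Matrix.of fun (i j : Fin 2) => ((y (ee, i, j, false) : ℝ) : ℂ) + ((y (ee, i, j, true) : ℝ) : ℂ) * Complex.I) a.1)ᴴ else (fun (ee : Edge 3 L) => Matrix.of fun (i j : Fin 2) => ((y (ee, i, j, false) : ℝ) : ℂ) + ((y (ee, i, j, true) : ℝ) : ℂ) * Complex.I) a.1)).prod).trace.re) (coords x) ∂(wilsonMeasure (d := 3) (L := L) (fundamentalRep (Fin 2)) β')))|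
      ≤ ∑ p : Plaquette 3 L, ∑ e' ∈ S₁, B * Real.exp (-(κ * ((Finset.univ.sup fun i : Fin 3 => ((e'.1 i - p.1 i).valMinAbs).natAbs : ℕ) : ℝ))) :=
        Finset.sum_le_sum fun p _ => hper p
    _ = ∑ e' ∈ S₁, B * ∑ p : Plaquette 3 L, Real.exp (-(κ * ((Finset.univ.sup fun i : Fin 3 => ((e'.1 i - p.1 i).valMinAbs).natAbs : ℕ) : ℝ))) := by
        rw [Finset.sum_comm]; exact Finset.sum_congr rfl fun e' _ => by rw [Finset.mul_sum]
    _ ≤ ∑ e' ∈ S₁, B * (3 * ((1 + 12 / ((1 - 12 * |β'|) * Real.log 108 / (2 * ((1300 + 4 * Real.sqrt 2) * |β'| + (1 - 12 * |β'|))))) ^ 3 / (1 - Real.exp (-(((1 - 12 * |β'|) * Real.log 108 / (2 * ((1300 + 4 * Real.sqrt 2) * |β'| + (1 - 12 * |β'|)))) / 2))))) := Finset.sum_le_sum fun e' _ => mul_le_mul_of_nonneg_left (hsite e') hB0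
    _ = (S₁.card : ℝ) * (B * (3 * ((1 + 12 / ((1 - 12 * |β'|) * Real.log 108 / (2 * ((1300 + 4 * Real.sqrt 2) * |β'| + (1 - 12 * |β'|))))) ^ 3 / (1 - Real.exp (-(((1 - 12 * |β'|) * Real.log 108 / (2 * ((1300 + 4 * Real.sqrt 2) * |β'| + (1 - 12 * |β'|)))) / 2)))))) := by rw [Finset.sum_const, nsmul_eq_mul]
    _ ≤ (l₁.length : ℝ) * (B * (3 * ((1 + 12 / ((1 - 12 * |β'|) * Real.log 108 / (2 * ((1300 + 4 * Real.sqrt 2) * |β'| + (1 - 12 * |β'|))))) ^ 3 / (1 - Real.exp (-(((1 - 12 * |β'|) * Real.log 108 / (2 * ((1300 + 4 * Real.sqrt 2) * |β'| + (1 - 12 * |β'|)))) / 2)))))) := mul_le_mul_of_nonneg_right hcardS (by positivity)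
    _ = 3 * (l₁.length : ℝ) * B * ((1 + 12 / ((1 - 12 * |β'|) * Real.log 108 / (2 * ((1300 + 4 * Real.sqrt 2) * |β'| + (1 - 12 * |β'|))))) ^ 3 / (1 - Real.exp (-(((1 - 12 * |β'|) * Real.log 108 / (2 * ((1300 + 4 * Real.sqrt 2) * |β'| + (1 - 12 * |β'|)))) / 2)))) := by ring

end Summit.QuantumFields.YangMills.Theorems.ColdStartUniversality.LiebRobinson
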